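import Mathlib

/-!
# SoloBlindDoorN — "door N" (uniform degree of the anchors' cycles) is equivalent to the face

solo-HodgeConjecture-blind, session s25 (`paper/k3-weil-faces.md` §3.7(d), §3.10; claims SB-C170…).

Informal context (nothing Hodge-theoretic is formalised here).  On the similarity face of the Hodge
conjecture for products of K3 surfaces (§3.7) one has an irreducible quasi-projective base `B` carrying a
flat rational class `ψ`, Hodge at every point, together with infinitely many pairwise distinct prime divisors
`H v ⊂ B` (Noether–Lefschetz divisors, Hecke translates of the level-3 anchor divisor `G` of §3.8(f)) at whose
generic points `ψ` is known to be algebraic.  For `D : ℕ` let `A D ⊆ B` be the locus where `ψ_b` has an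
algebraic representative of degree `≤ D`; by properness of the relative Chow scheme and flatness of `ψ`,
`A D` is Zariski closed (this geometric input is a HYPOTHESIS `hA` below, not proved here), and "algebraic at
the generic point of `H v`" gives `H v ⊆ A (d v)` for some `d v`.  "Door N" of §3.7(d) was the sufficient
condition: if the degrees `d v` are bounded along infinitely many anchors then `ψ` is algebraic everywhere.

What this file proves (abstract Noetherian topology, kernel-checked):
* `finite_primeDivisors_subset`: a proper closed subset of a Noetherian space contains only finitely
  many prime divisors (irreducible closed subsets that are maximal among proper irreducible closed subsets);
* `exists_eq_univ_iff_exists_infinite`: for ANY family of closed sets `A D` and any injective family of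
  prime divisors `H v`, `(∃ D, A D = univ) ↔ (∃ D, {v | H v ⊆ A D} is infinite)` — so door N is not a door
  but a RESTATEMENT of "ψ algebraic everywhere (with some degree)": uniformity of the anchors' cycles is
  exactly as hard as the face itself;
* `tendsto_degree_atTop`: the contrapositive, which is the only falsifiable content — if `ψ` is not
  algebraic with bounded degree on all of `B`, then along ANY injective family of anchor divisors the minimal
  degrees of representing cycles tend to infinity (cofinite filter).
The dictionary `B ↦ α` uses only that the Zariski topology of a variety is Noetherian and that prime divisors
of an irreducible variety are maximal proper irreducible closed subsets.
-/

namespace Summit.HodgeConjecture.HodgeConjecture.Theorems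
namespace DoorN

open Set TopologicalSpace

variable {α : Type*} [TopologicalSpace α]

variable (α) in
/-- The abstract *prime divisors* of `α`: irreducible closed subsets `H` such that every irreducible closed
subset containing `H` is `H` itself or the whole space. -/
def primeDivisors : Set (Set α) :=
  {H | IsIrreducible H ∧ IsClosed H ∧
    ∀ C : Set α, IsIrreducible C → IsClosed C → H ⊆ C → C = H ∨ C = univ}

/-- A proper closed subset of a Noetherian space contains only finitely many prime divisors. -/
theorem finite_primeDivisors_subset [NoetherianSpace α] {Z : Set α} (hZ : IsClosed Z)
    (hZne : Z ≠ univ) : {H : Set α | H ∈ primeDivisors α ∧ H ⊆ Z}.Finite := by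
  obtain ⟨S, hSf, hSc, hSi, hZS⟩ := NoetherianSpace.exists_finite_set_isClosed_irreducible hZ
  lift S to Finset (Set α) using hSf
  refine S.finite_toSet.subset ?_
  rintro H ⟨⟨hHirr, -, hHmax⟩, hHZ⟩
  obtain ⟨t, htS, hHt⟩ := isIrreducible_iff_sUnion_isClosed.1 hHirr S
    (fun z hz => hSc z (Finset.mem_coe.2 hz)) (hHZ.trans hZS.subset)
  rcases hHmax t (hSi t (Finset.mem_coe.2 htS)) (hSc t (Finset.mem_coe.2 htS)) hHt with h | h
  · subst h
    exact Finset.mem_coe.2 htS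
  · exfalso
    apply hZne
    rw [hZS]
    apply eq_univ_of_univ_subset
    rw [← h]
    exact subset_sUnion_of_mem (Finset.mem_coe.2 htS)

/-- For every "degree bound" `D` whose locus `A D` is a proper closed subset, only finitely many of the
anchor divisors lie in `A D`. -/
theorem finite_setOf_subset [NoetherianSpace α] {ι : Type*} (A : ℕ → Set α)
    (hA : ∀ D, IsClosed (A D)) (H : ι → Set α) (hH : ∀ v, H v ∈ primeDivisors α)
    (hinj : Function.Injective H) {D : ℕ} (hne : A D ≠ univ) : {v | H v ⊆ A D}.Finite := by
  have hfin := finite_primeDivisors_subset (hA D) hne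
  have hsub : {v | H v ⊆ A D} ⊆ H ⁻¹' {K : Set α | K ∈ primeDivisors α ∧ K ⊆ A D} :=
    fun v hv => ⟨hH v, hv⟩
  exact (hfin.preimage fun _ _ _ _ h => hinj h).subset hsub

/-- DOOR N IS THE FACE.  With `A D` = "representative of degree `≤ D` exists" (closed) and `H v` an injective
family of anchor prime divisors: some `A D` is everything iff the degrees are bounded on an infinite set of
anchors.  (`→` is trivial; `←` is `finite_setOf_subset`.) -/
theorem exists_eq_univ_iff_exists_infinite [NoetherianSpace α] {ι : Type*} [Infinite ι]
    (A : ℕ → Set α) (hA : ∀ D, IsClosed (A D)) (H : ι → Set α) (hH : ∀ v, H v ∈ primeDivisors α)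
    (hinj : Function.Injective H) :
    (∃ D, A D = univ) ↔ ∃ D, {v | H v ⊆ A D}.Infinite := by
  constructor
  · rintro ⟨D, hD⟩
    refine ⟨D, ?_⟩
    have h : {v | H v ⊆ A D} = univ := by
      ext v
      simp [hD]
    rw [h]
    exact Set.infinite_univ
  · rintro ⟨D, hD⟩
    by_contra hne
    simp only [not_exists] at hne
    exact hD (finite_setOf_subset A hA H hH hinj (hne D))

/-- The falsifiable content (contrapositive): if no `A D` is the whole base, then along any injective
family of anchor divisors with `H v ⊆ A (d v)` the degrees `d v` tend to infinity. -/
theorem tendsto_degree_atTop [NoetherianSpace α] {ι : Type*} (A : ℕ → Set α)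
    (hA : ∀ D, IsClosed (A D)) (hne : ∀ D, A D ≠ univ) (H : ι → Set α)
    (hH : ∀ v, H v ∈ primeDivisors α) (hinj : Function.Injective H) (d : ι → ℕ)
    (hd : ∀ v, H v ⊆ A (d v)) : Filter.Tendsto d Filter.cofinite Filter.atTop := by
  rw [Filter.tendsto_atTop]
  intro b
  rw [Filter.eventually_cofinite]
  have hsub : {v | ¬b ≤ d v} ⊆ ⋃ D ∈ Set.Iio b, {v | H v ⊆ A D} := by
    intro v hv
    simp only [not_le, mem_setOf_eq] at hv
    exact Set.mem_biUnion (Set.mem_Iio.2 hv) (hd v)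
  exact ((Set.finite_Iio b).biUnion fun D _ => finite_setOf_subset A hA H hH hinj (hne D)).subset hsub

end DoorN
end Summit.HodgeConjecture.HodgeConjecture.Theorems
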